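import Mathlib.LinearAlgebra.Matrix.Permanent
import Mathlib.GroupTheory.Perm.Fin
import Mathlib.Algebra.BigOperators.Fin
import Mathlib.Algebra.BigOperators.Intervals
import Literature.LinearAlgebra.Matrix.PermanentLaplace
import Literature.Computability.AlgebraicComplexity.PermanentCompleteness
import HarnessLib

/-!
# Universality of the permanent for arithmetic expressions — discharge of `BCS1997_thm_21_27`

D-0014 keeps `Literature/` sorry-free by stating cited results as named facts. This file proves
the named fact `Literature.Computability.AlgebraicComplexity.BCS1997_thm_21_27` of
`PermanentCompleteness.lean` — Bürgisser–Clausen–Shokrollahi 1997, Thm. (21.27) for the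
permanent together with property (D) of its proof (Valiant 1979, universality of the
permanent): every arithmetic expression `φ` of size `u = E(φ)` over `I = k ∪ {X_i}` is the
permanent of a `(2u+2) × (2u+2)` matrix over `I` having in each column at most one entry which
is an indeterminate:

* `Literature.Computability.AlgebraicComplexity.BCS1997_thm_21_27_holds : BCS1997_thm_21_27 k`.

This is the second of the three printed steps of Valiant's `VNP`-completeness of `PER`
(assembly `isVNPComplete_perPoly_of` in `PermanentCompleteness.lean`).

## The printed proof and the one formalised

BCS (pp. 583–584 of the book) define `μ(φ) ∈ I^{s × s}`, `s = 2u + 2`, by induction along the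
construction of `φ`: a leaf `φ ∈ I` gets the `2 × 2` matrix `((φ, 0), (1, 1))`; a product gets a
block triangular matrix; a sum is handled by Lemma (21.28) (a Laplace expansion merging two
matrices of the normal form (C): first row `(α, 0)`, an upper unitriangular block `A`, last
column `β`), and "the universality of PER is shown in a similar way". We formalise the same
induction in the language that makes the normal form (C) transparent: an `s × s` matrix `M` with
`M_{c+1,c} = 1` and `M_{r,c} = 0` for `r ≥ c + 2` (lower Hessenberg with unit subdiagonal — this
is (C) up to the bookkeeping of the first row/last column) is the matrix of the *weighted
transitive DAG* on `{0, …, s}` with edge weights `w(r, c+1) := M_{r,c}` (`r ≤ c`), and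

  `per M = ∑_{paths 0 = v₀ < v₁ < ⋯ < v_m = s} ∏ w(v_i, v_{i+1})`        (`permanent_hess`)

(the permutations contributing to `per M` are the products of the cycles `(a a+1 … b)`, i.e. the
tilings of `{0,…,s-1}` by intervals `[a,b]` of weight `M_{a,b}`, i.e. the paths from `0` to `s`;
we prove it by the Laplace expansion along the last row, `Matrix.permanent_eq_sum_row`, which has
the two entries `M_{s-1,s-2} = 1` and `M_{s-1,s-1}`). Then `μ` becomes (`ArithExpr.dagWeights`):
a leaf `ℓ` is the path `0 →ℓ 1 →1 2` (`s = 2`); a product `φ₁ * φ₂` is the series composition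
(the DAG of `φ₂` shifted by `s₁`, its source identified with the sink of `φ₁`; `s = s₁ + s₂`,
`pathSum_series`: every path passes through `s₁`, the path sum is the product); a sum `φ₁ + φ₂`
is the parallel composition (both DAGs leave the common source `0`, the other vertices of `φ₂`
are shifted by `s₁`, and a bridge `s₁ → s₁ + s₂` of weight `1` joins the sink of `φ₁` to the
common sink; `s = s₁ + s₂`, `pathSum_parallel`: every path runs in one half, the path sum is the
sum). In all cases `s = 2u + 2` on the nose ((B) of the printed proof). Property (D) — at most
one indeterminate per column — says that every vertex has at most one incoming edge weighted by
an indeterminate (`ColUnique`); it is preserved by both compositions because the only new edge,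
the bridge, is the constant `1` (`ArithExpr.colUnique_dagWeights`; BCS additionally record "the
last column contains no indeterminate", which their merging of sinks needs and ours does not).
Finally `per μ(φ) = val(φ)` is `ArithExpr.entryPer_toMatrix` ((A) of the printed proof), over
every commutative semiring `k`.

## Contents

* `pathSum w n`, `pathSum_succ`, `pathSum_congr`, `pathSum_series`, `pathSum_parallel` — path
  sums of weighted transitive DAGs on `ℕ`.
* `hess n w` and `permanent_hess : per (hess n w) = pathSum w n`.
* `leafW`, `seriesW`, `parallelW`, `ArithExpr.dagWeights`, `ArithExpr.toMatrix` — the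
  construction `μ`; `ArithExpr.entryPer_toMatrix` (A)+(B), `ArithExpr.hasColumnProperty_toMatrix`
  (D); `BCS1997_thm_21_27_holds`.

## References

* P. Bürgisser, M. Clausen, M. A. Shokrollahi, *Algebraic Complexity Theory*, Grundlehren 315,
  Springer 1997, Thm. (21.27) and its proof (properties (A)–(D)), Lemma (21.28), pp. 582–584;
  Ex. 21.7 (Valiant's more compact construction).
* L. G. Valiant, *Completeness classes in algebra*, Proc. 11th STOC (1979), 249–261, §2
  (universality of the permanent/determinant for formulas).
-/

noncomputable section

open MvPolynomial Matrix Finset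

namespace Literature.Computability.AlgebraicComplexity

universe u v

/-! ### Path sums and lower Hessenberg matrices -/

section PathSum

variable {R : Type*} [CommSemiring R]

/-- The weighted path count `P_w(b)` from `0` to `b` in the transitive DAG on `ℕ` with edge
weights `w a c` (`a < c`): `P_w(0) = 1`, `P_w(b+1) = ∑_{a ≤ b} P_w(a) · w a (b+1)`. [folklore] -/
def pathSum (w : ℕ → ℕ → R) : ℕ → R
  | 0 => 1
  | b + 1 => ∑ a : Fin (b + 1), pathSum w a.val * w a.val (b + 1)
decreasing_by exact a.isLt

/-- The empty path: `P_w(0) = 1`. [folklore] -/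
theorem pathSum_zero (w : ℕ → ℕ → R) : pathSum w 0 = 1 := by
  rw [pathSum]

/-- The defining recursion of the path sum, as a sum over `Finset.range`: the last edge of a
path to `b + 1` leaves from some `a ≤ b`. [folklore] -/
theorem pathSum_succ (w : ℕ → ℕ → R) (b : ℕ) :
    pathSum w (b + 1) = ∑ a ∈ range (b + 1), pathSum w a * w a (b + 1) := by
  rw [pathSum, Fin.sum_univ_eq_sum_range (fun a => pathSum w a * w a (b + 1)) (b + 1)]

/-- Locality: `P_w(n)` only depends on the weights of the edges with target `≤ n`. [folklore] -/
theorem pathSum_congr {w w' : ℕ → ℕ → R} {n : ℕ} (h : ∀ a c, c ≤ n → w a c = w' a c) :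
    pathSum w n = pathSum w' n := by
  induction n using Nat.strong_induction_on with
  | _ n ih =>
    cases n with
    | zero => rw [pathSum_zero, pathSum_zero]
    | succ b =>
      rw [pathSum_succ, pathSum_succ]
      refine sum_congr rfl fun a ha => ?_
      rw [mem_range] at ha
      rw [ih a ha (fun a' c hc => h a' c (by omega)), h a (b + 1) le_rfl]

/-- `P_w(1) = w(0,1)`. [folklore] -/
theorem pathSum_one (w : ℕ → ℕ → R) : pathSum w 1 = w 0 1 := by
  rw [pathSum_succ, sum_range_one, pathSum_zero, one_mul]

/-- `P_w(2) = w(0,2) + w(0,1) w(1,2)`. [folklore] -/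
theorem pathSum_two (w : ℕ → ℕ → R) : pathSum w 2 = w 0 2 + w 0 1 * w 1 2 := by
  rw [pathSum_succ, sum_range_succ, sum_range_one, pathSum_zero, one_mul, pathSum_one]

/-- The lower Hessenberg matrix of a weighted transitive DAG on `{0, …, n}`: entry `(r, c)` is `1`
on the subdiagonal `r = c + 1`, the weight `w r (c+1)` of the edge `r → c + 1` for `r ≤ c`, and
`0` below the subdiagonal (the normal form (C) of BCS 1997, proof of Thm. (21.27): an upper
unitriangular block bordered by a first row and a last column). [cite: BurgisserClausenShokrollahi1997, Thm. (21.27) (C)] -/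
def hess (n : ℕ) (w : ℕ → ℕ → R) : Matrix (Fin n) (Fin n) R := fun r c =>
  if r.val = c.val + 1 then 1 else if r.val ≤ c.val then w r.val (c.val + 1) else 0

/-- **The permanent of a lower Hessenberg matrix with unit subdiagonal is the path sum of its
DAG**: `per (hess n w) = P_w(n)`. Proof by the Laplace expansion along the last row
(`Matrix.permanent_eq_sum_row`), whose only entries are the subdiagonal `1` (its minor is the
Hessenberg matrix of the DAG in which the vertex `n - 1` is skipped, i.e. the edges into `n` are
redirected into `n - 1`) and the corner `w(n-1, n)` (its minor is `hess (n-1) w`); this is the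
permanent reading of the normal form (C) in BCS 1997, proof of Thm. (21.27), and of
Lemma (21.28). [cite: BurgisserClausenShokrollahi1997, Lemma (21.28)] -/
theorem permanent_hess (n : ℕ) (w : ℕ → ℕ → R) : (hess n w).permanent = pathSum w n := by
  induction n generalizing w with
  | zero => rw [pathSum_zero]; exact permanent_isEmpty
  | succ m ih =>
    rw [permanent_eq_sum_row _ (Fin.last m), Fin.sum_univ_castSucc]
    have hlast : hess (m + 1) w (Fin.last m) (Fin.last m) = w m (m + 1) := by
      simp [hess]
    have hminor_last : (hess (m + 1) w).submatrix (Fin.last m).succAbove (Fin.last m).succAbove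
        = hess m w := by
      ext r c
      simp [hess, Fin.succAbove_last]
    rw [hlast, hminor_last, ih w]
    cases m with
    | zero =>
      rw [pathSum_one, pathSum_zero]
      simp
    | succ m' =>
      -- the castSucc part of the last row has a single nonzero entry, at column `m'`
      rw [Finset.sum_eq_single (Fin.last m')]
      · -- main identity
        have hentry : hess (m' + 2) w (Fin.last (m' + 1)) (Fin.castSucc (Fin.last m')) = 1 := by
          simp [hess]
        set w' : ℕ → ℕ → R := fun a c => if c = m' + 1 then w a (m' + 2) else w a c with hw'
        have hminor : (hess (m' + 2) w).submatrix (Fin.last (m' + 1)).succAbove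
            (Fin.castSucc (Fin.last m')).succAbove = hess (m' + 1) w' := by
          ext r c
          rcases Fin.eq_castSucc_or_eq_last c with ⟨c', rfl⟩ | rfl
          · have h1 : (Fin.castSucc (Fin.last m')).succAbove (Fin.castSucc c') =
                Fin.castSucc (Fin.castSucc c') :=
              Fin.succAbove_of_castSucc_lt _ _ (Fin.castSucc_lt_castSucc_iff.2 (Fin.castSucc_lt_last c'))
            have hc' := c'.isLt
            simp [hess, h1, Fin.succAbove_last, hw', Nat.ne_of_lt hc']
          · have h1 : (Fin.castSucc (Fin.last m')).succAbove (Fin.last m') = Fin.last (m' + 1) := by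
              rw [Fin.succAbove_of_le_castSucc _ _ le_rfl, Fin.succ_last]
            have hr := r.isLt
            have hv : ((Fin.last (m' + 1) : Fin (m' + 2)) : ℕ) = m' + 1 := rfl
            simp [hess, h1, Fin.succAbove_last, hw']
            rw [if_neg (by omega), if_neg (by omega), if_pos (by omega)]
        rw [hentry, one_mul, hminor, ih w', pathSum_succ, pathSum_succ w (m' + 1),
          Finset.sum_range_succ (fun a => pathSum w a * w a (m' + 2))]
        congr 1
        · refine sum_congr rfl fun a ha => ?_
          rw [mem_range] at ha
          rw [pathSum_congr (w := w') (w' := w) (fun a' c hc => by rw [hw']; dsimp only; rw [if_neg (by omega)])]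
          simp [hw']
        · ring
      · intro j _ hj
        have : hess (m' + 2) w (Fin.last (m' + 1)) (Fin.castSucc j) = 0 := by
          have hj' : j.val ≠ m' := fun h => hj (Fin.ext (by rw [Fin.val_last]; exact h))
          have hjlt := j.isLt
          have e1 : ¬ (m' + 1 = j.val + 1) := by omega
          have e2 : ¬ (m' + 1 ≤ j.val) := by omega
          simp only [hess, Fin.val_last, Fin.val_castSucc, e1, e2, if_false]
        rw [this, zero_mul]
      · intro h; exact absurd (mem_univ _) h


/-- **Series composition**: if the weights `w` on `{0, …, n₁ + n₂}` agree with `w₁` on targets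
`≤ n₁`, with `w₂` shifted by `n₁` on sources `≥ n₁`, and vanish from sources `< n₁` to targets
`> n₁`, then every path passes through `n₁` and `P_w(n₁ + n₂) = P_{w₁}(n₁) · P_{w₂}(n₂)`. [folklore] -/
theorem pathSum_series {w w₁ w₂ : ℕ → ℕ → R} {n₁ n₂ : ℕ}
    (h₁ : ∀ a b, b ≤ n₁ → w a b = w₁ a b)
    (h₂ : ∀ a b, n₁ ≤ a → n₁ < b → w a b = w₂ (a - n₁) (b - n₁))
    (h₀ : ∀ a b, a < n₁ → n₁ < b → w a b = 0) :
    pathSum w (n₁ + n₂) = pathSum w₁ n₁ * pathSum w₂ n₂ := by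
  have hw₁ : ∀ a, a ≤ n₁ → pathSum w a = pathSum w₁ a := fun a ha =>
    pathSum_congr fun a' c hc => h₁ a' c (hc.trans ha)
  suffices H : ∀ c, c ≤ n₂ → pathSum w (n₁ + c) = pathSum w₁ n₁ * pathSum w₂ c from H n₂ le_rfl
  intro c
  induction c using Nat.strong_induction_on with
  | _ c ih =>
    intro hc
    cases c with
    | zero => rw [Nat.add_zero, hw₁ n₁ le_rfl, pathSum_zero, mul_one]
    | succ c =>
      rw [show n₁ + (c + 1) = (n₁ + c) + 1 by omega, pathSum_succ,
        show n₁ + c + 1 = n₁ + (c + 1) by omega, Finset.sum_range_add, pathSum_succ w₂ c,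
        Finset.mul_sum]
      have hvan : ∑ a ∈ range n₁, pathSum w a * w a (n₁ + (c + 1)) = 0 :=
        Finset.sum_eq_zero fun a ha => by
          rw [mem_range] at ha
          rw [h₀ a _ ha (by omega), mul_zero]
      rw [hvan, zero_add]
      refine sum_congr rfl fun x hx => ?_
      rw [mem_range] at hx
      rw [ih x hx (by omega), h₂ (n₁ + x) _ (by omega) (by omega), Nat.add_sub_cancel_left,
        Nat.add_sub_cancel_left]
      ring

/-- **Parallel composition**: weights on `{0, …, n₁ + n₂}` that agree with `w₁` on targets
`≤ n₁`, with `w₂` (sources `0` and `> n₁`, shifted by `n₁`) on targets `> n₁`, with a bridge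
`n₁ → n₁ + n₂` of weight `1` and no other edges between the two halves: every path runs in one
half, so `P_w(n₁ + n₂) = P_{w₁}(n₁) + P_{w₂}(n₂)`. [folklore] -/
theorem pathSum_parallel {w w₁ w₂ : ℕ → ℕ → R} {n₁ n₂ : ℕ} (hn₁ : 1 ≤ n₁) (hn₂ : 1 ≤ n₂)
    (h₁ : ∀ a b, b ≤ n₁ → w a b = w₁ a b)
    (hsrc : ∀ b, n₁ < b → b ≤ n₁ + n₂ → w 0 b = w₂ 0 (b - n₁))
    (h₂ : ∀ a b, n₁ < a → a < b → b ≤ n₁ + n₂ → w a b = w₂ (a - n₁) (b - n₁))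
    (hbr : w n₁ (n₁ + n₂) = 1)
    (hz₁ : ∀ a b, 0 < a → a < n₁ → n₁ < b → b ≤ n₁ + n₂ → w a b = 0)
    (hz₂ : ∀ b, n₁ < b → b < n₁ + n₂ → w n₁ b = 0) :
    pathSum w (n₁ + n₂) = pathSum w₁ n₁ + pathSum w₂ n₂ := by
  have hw₁ : ∀ a, a ≤ n₁ → pathSum w a = pathSum w₁ a := fun a ha =>
    pathSum_congr fun a' c hc => h₁ a' c (hc.trans ha)
  suffices H : ∀ c, 1 ≤ c → c ≤ n₂ →
      pathSum w (n₁ + c) = pathSum w₂ c + if c = n₂ then pathSum w₁ n₁ else 0 by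
    rw [H n₂ hn₂ le_rfl, if_pos rfl, add_comm]
  intro c
  induction c using Nat.strong_induction_on with
  | _ c ih =>
    intro hc1 hc
    obtain ⟨c, rfl⟩ : ∃ c', c = c' + 1 := ⟨c - 1, by omega⟩
    obtain ⟨m, rfl⟩ : ∃ m, n₁ = m + 1 := ⟨n₁ - 1, by omega⟩
    rw [show m + 1 + (c + 1) = (m + 1 + c) + 1 by omega, pathSum_succ,
      show m + 1 + c + 1 = (m + 1) + (c + 1) by omega, Finset.sum_range_add,
      Finset.sum_range_succ' (fun a => pathSum w a * w a ((m + 1) + (c + 1))),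
      Finset.sum_range_succ' (fun x => pathSum w (m + 1 + x) * w (m + 1 + x) ((m + 1) + (c + 1)))]
    -- sources `1 ≤ a < n₁`: no edge to the second half
    have hvan₁ : ∑ a ∈ range m, pathSum w (a + 1) * w (a + 1) (m + 1 + (c + 1)) = 0 :=
      Finset.sum_eq_zero fun a ha => by
        rw [mem_range] at ha
        rw [hz₁ (a + 1) _ (by omega) (by omega) (by omega) (by omega), mul_zero]
    -- source `0`
    have hsrc' : pathSum w 0 * w 0 (m + 1 + (c + 1)) = w₂ 0 (c + 1) := by
      rw [pathSum_zero, one_mul, hsrc _ (by omega) (by omega), Nat.add_sub_cancel_left]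
    -- the bridge `n₁ → n₁ + n₂`
    have hbr' : pathSum w (m + 1 + 0) * w (m + 1 + 0) (m + 1 + (c + 1)) =
        if c + 1 = n₂ then pathSum w₁ (m + 1) else 0 := by
      rw [Nat.add_zero, hw₁ _ le_rfl]
      split_ifs with h
      · rw [h, hbr, mul_one]
      · rw [hz₂ _ (by omega) (by omega), mul_zero]
    -- sources in the second half
    have hmid : ∑ x ∈ range c, pathSum w (m + 1 + (x + 1)) * w (m + 1 + (x + 1)) (m + 1 + (c + 1)) =
        ∑ x ∈ range c, pathSum w₂ (x + 1) * w₂ (x + 1) (c + 1) := by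
      refine sum_congr rfl fun x hx => ?_
      rw [mem_range] at hx
      rw [ih (x + 1) (by omega) (by omega) (by omega), if_neg (by omega), add_zero,
        h₂ _ _ (by omega) (by omega) (by omega), Nat.add_sub_cancel_left, Nat.add_sub_cancel_left]
    rw [hvan₁, zero_add, hsrc', hbr', hmid, pathSum_succ w₂ c, Finset.sum_range_succ', pathSum_zero,
      one_mul]
    ring

end PathSum

/-! ### The weighted DAG of an expression and its matrix (BCS 1997, proof of Thm. (21.27)) -/

section ExprDAG

variable {k : Type u} [CommSemiring k] {σ : Type v}

/-- Weights of the DAG of a leaf `ℓ ∈ k ∪ X` on the vertices `{0, 1, 2}`: `0 → 1` of weight `ℓ`,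
`1 → 2` of weight `1`, no edge `0 → 2` (BCS 1997, proof of Thm. (21.27), Case 1, `u = 0`,
matrix `((φ, 0), (1, 1))`). [cite: BurgisserClausenShokrollahi1997, Thm. (21.27)] -/
def leafW (ℓ : k ⊕ σ) : ℕ → ℕ → k ⊕ σ := fun a b =>
  if a = 0 ∧ b = 1 then ℓ else if a = 1 ∧ b = 2 then Sum.inl 1 else Sum.inl 0

/-- Series composition of two weighted DAGs on `{0,…,n₁}` and `{0,…,n₂}`: the second is shifted by
`n₁` (its source is identified with the sink `n₁` of the first), no edges between the two halves
(BCS 1997, proof of Thm. (21.27), Case 2, `φ = φ₁ * φ₂`, block triangular matrix). [cite: BurgisserClausenShokrollahi1997, Thm. (21.27)] -/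
def seriesW (n₁ : ℕ) (W₁ W₂ : ℕ → ℕ → k ⊕ σ) : ℕ → ℕ → k ⊕ σ := fun a b =>
  if b ≤ n₁ then W₁ a b else if n₁ ≤ a then W₂ (a - n₁) (b - n₁) else Sum.inl 0

/-- Parallel composition of two weighted DAGs on `{0,…,n₁}` and `{0,…,n₂}`: both keep the source
`0`, the other vertices of the second are shifted by `n₁`, and a bridge `n₁ → n₁ + n₂` of weight
`1` joins the sink of the first to the common sink (BCS 1997, proof of Thm. (21.27), Case 3,
`φ = φ₁ + φ₂`, via Lemma (21.28)). [cite: BurgisserClausenShokrollahi1997, Thm. (21.27)] -/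
def parallelW (n₁ n₂ : ℕ) (W₁ W₂ : ℕ → ℕ → k ⊕ σ) : ℕ → ℕ → k ⊕ σ := fun a b =>
  if b ≤ n₁ then W₁ a b
  else if a = 0 then W₂ 0 (b - n₁)
  else if n₁ < a then W₂ (a - n₁) (b - n₁)
  else if a = n₁ ∧ b = n₁ + n₂ then Sum.inl 1 else Sum.inl 0

namespace ArithExpr

/-- The weighted DAG `μ(φ)` of an expression, on the vertices `{0, …, 2E(φ)+2}` with weights in
`I = k ∪ X`, defined along the construction of `φ` (BCS 1997, proof of Thm. (21.27): leaves,
products = series composition, sums = parallel composition). [cite: BurgisserClausenShokrollahi1997, Thm. (21.27)] -/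
def dagWeights : ArithExpr k σ → ℕ → ℕ → k ⊕ σ
  | var i => leafW (Sum.inr i)
  | const c => leafW (Sum.inl c)
  | mul φ₁ φ₂ => seriesW (2 * φ₁.size + 2) φ₁.dagWeights φ₂.dagWeights
  | add φ₁ φ₂ => parallelW (2 * φ₁.size + 2) (2 * φ₂.size + 2) φ₁.dagWeights φ₂.dagWeights

/-- The `(2u+2) × (2u+2)` matrix `μ(φ)` over `I = k ∪ X` of an expression `φ` of size `u`
(BCS 1997, Thm. (21.27)): the lower Hessenberg matrix of the DAG `φ.dagWeights` — entry `(r, c)`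
is `1` if `r = c + 1`, the weight of the edge `r → c + 1` if `r ≤ c`, and `0` below the
subdiagonal. [cite: BurgisserClausenShokrollahi1997, Thm. (21.27)] -/
def toMatrix (φ : ArithExpr k σ) :
    Matrix (Fin (2 * φ.size + 2)) (Fin (2 * φ.size + 2)) (k ⊕ σ) := fun r c =>
  if r.val = c.val + 1 then Sum.inl 1
  else if r.val ≤ c.val then φ.dagWeights r.val (c.val + 1) else Sum.inl 0

end ArithExpr

/-- The polynomial weights of an `I`-weighted DAG (`c ↦ C c`, `X_i ↦ X_i`). [cite: BurgisserClausenShokrollahi1997, (21.12)] -/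
abbrev wval (W : ℕ → ℕ → k ⊕ σ) : ℕ → ℕ → MvPolynomial σ k := fun a b => entryVal (W a b)

/-- The matrix of an expression, read in `k[X]`, is the lower Hessenberg matrix of the polynomial
weights of its DAG. [cite: BurgisserClausenShokrollahi1997, Thm. (21.27)] -/
theorem ArithExpr.map_toMatrix (φ : ArithExpr k σ) :
    φ.toMatrix.map entryVal = hess (2 * φ.size + 2) (wval φ.dagWeights) := by
  ext r c
  simp only [Matrix.map_apply, ArithExpr.toMatrix, hess, wval]
  split_ifs <;> simp

/-- Path sum of a leaf DAG: the single path `0 → 1 → 2` of weight `ℓ · 1`. [cite: BurgisserClausenShokrollahi1997, Thm. (21.27)] -/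
theorem pathSum_leafW (ℓ : k ⊕ σ) : pathSum (wval (leafW ℓ)) 2 = entryVal ℓ := by
  rw [pathSum_two]
  simp [wval, leafW]

/-- Path sum of a series composition = product of the path sums. [cite: BurgisserClausenShokrollahi1997, Thm. (21.27)] -/
theorem pathSum_seriesW (n₁ n₂ : ℕ) (W₁ W₂ : ℕ → ℕ → k ⊕ σ) :
    pathSum (wval (seriesW n₁ W₁ W₂)) (n₁ + n₂) = pathSum (wval W₁) n₁ * pathSum (wval W₂) n₂ := by
  refine pathSum_series (fun a b hb => ?_) (fun a b ha hb => ?_) (fun a b ha hb => ?_)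
  · simp [wval, seriesW, hb]
  · simp [wval, seriesW, not_le.2 hb, ha]
  · simp [wval, seriesW, not_le.2 hb, not_le.2 ha]

/-- Path sum of a parallel composition = sum of the path sums. [cite: BurgisserClausenShokrollahi1997, Thm. (21.27)] -/
theorem pathSum_parallelW {n₁ n₂ : ℕ} (hn₁ : 1 ≤ n₁) (hn₂ : 1 ≤ n₂) (W₁ W₂ : ℕ → ℕ → k ⊕ σ) :
    pathSum (wval (parallelW n₁ n₂ W₁ W₂)) (n₁ + n₂) =
      pathSum (wval W₁) n₁ + pathSum (wval W₂) n₂ := by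
  refine pathSum_parallel hn₁ hn₂ (fun a b hb => ?_) (fun b hb _ => ?_) (fun a b ha _ _ => ?_) ?_
    (fun a b ha0 ha hb _ => ?_) (fun b hb hb' => ?_)
  · simp [wval, parallelW, hb]
  · simp [wval, parallelW, not_le.2 hb]
  · have hb : ¬ b ≤ n₁ := by omega
    simp [wval, parallelW, hb, ha, Nat.ne_of_gt (lt_of_le_of_lt (Nat.zero_le _) ha)]
  · simp [wval, parallelW, not_le.2 (Nat.lt_add_of_pos_right hn₂ : n₁ < n₁ + n₂), Nat.ne_of_gt hn₁]
  · simp [wval, parallelW, not_le.2 hb, Nat.ne_of_gt ha0, not_lt.2 ha.le, Nat.ne_of_lt ha]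
  · simp [wval, parallelW, not_le.2 hb, Nat.ne_of_gt hn₁, Nat.ne_of_lt hb']

/-- **Property (A)**: the path sum of the DAG of `φ` is `val(φ)` (BCS 1997, proof of Thm. (21.27),
(A) `val(φ) = per μ(φ)` combined with `permanent_hess`). [cite: BurgisserClausenShokrollahi1997, Thm. (21.27)] -/
theorem ArithExpr.pathSum_dagWeights (φ : ArithExpr k σ) :
    pathSum (wval φ.dagWeights) (2 * φ.size + 2) = φ.eval := by
  induction φ with
  | var i => exact pathSum_leafW _
  | const c => exact pathSum_leafW _
  | mul φ₁ φ₂ ih₁ ih₂ =>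
    rw [ArithExpr.size_mul, ArithExpr.eval_mul, ← ih₁, ← ih₂,
      show 2 * (φ₁.size + φ₂.size + 1) + 2 = (2 * φ₁.size + 2) + (2 * φ₂.size + 2) by ring]
    exact pathSum_seriesW _ _ _ _
  | add φ₁ φ₂ ih₁ ih₂ =>
    rw [ArithExpr.size_add, ArithExpr.eval_add, ← ih₁, ← ih₂,
      show 2 * (φ₁.size + φ₂.size + 1) + 2 = (2 * φ₁.size + 2) + (2 * φ₂.size + 2) by ring]
    exact pathSum_parallelW (by omega) (by omega) _ _

/-- **Properties (A), (B)**: `per μ(φ) = val(φ)` for the `(2u+2) × (2u+2)` matrix of an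
expression of size `u` (BCS 1997, Thm. (21.27) for the permanent). [cite: BurgisserClausenShokrollahi1997, Thm. (21.27)] -/
theorem ArithExpr.entryPer_toMatrix (φ : ArithExpr k σ) : entryPer φ.toMatrix = φ.eval := by
  rw [entryPer, ArithExpr.map_toMatrix, permanent_hess, ArithExpr.pathSum_dagWeights]

/-! ### Property (D): at most one indeterminate in each column -/

/-- Each vertex of an `I`-weighted DAG has at most one incoming edge weighted by an
indeterminate (BCS 1997, proof of Thm. (21.27), property (D), read on the DAG). [cite: BurgisserClausenShokrollahi1997, Thm. (21.27) (D)] -/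
def ColUnique (W : ℕ → ℕ → k ⊕ σ) : Prop :=
  ∀ b a a', (W a b).isRight = true → (W a' b).isRight = true → a = a'

/-- Leaves have property (D). [cite: BurgisserClausenShokrollahi1997, Thm. (21.27) (D)] -/
theorem colUnique_leafW (ℓ : k ⊕ σ) : ColUnique (leafW ℓ) := by
  intro b a a' ha ha'
  simp only [leafW] at ha ha'
  split_ifs at ha ha' <;> simp_all

/-- Series composition preserves property (D). [cite: BurgisserClausenShokrollahi1997, Thm. (21.27) (D)] -/
theorem colUnique_seriesW {n₁ : ℕ} {W₁ W₂ : ℕ → ℕ → k ⊕ σ} (h₁ : ColUnique W₁)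
    (h₂ : ColUnique W₂) : ColUnique (seriesW n₁ W₁ W₂) := by
  intro b a a' ha ha'
  simp only [seriesW] at ha ha'
  by_cases hb : b ≤ n₁
  · rw [if_pos hb] at ha ha'
    exact h₁ b a a' ha ha'
  · rw [if_neg hb] at ha ha'
    split_ifs at ha ha' with hh hh' hh'
    · have := h₂ _ _ _ ha ha'; omega
    · simp at ha'
    · simp at ha
    · simp at ha

/-- Parallel composition preserves property (D) (the bridge into the common sink is the constant
`1`). [cite: BurgisserClausenShokrollahi1997, Thm. (21.27) (D)] -/
theorem colUnique_parallelW {n₁ n₂ : ℕ} {W₁ W₂ : ℕ → ℕ → k ⊕ σ} (h₁ : ColUnique W₁)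
    (h₂ : ColUnique W₂) : ColUnique (parallelW n₁ n₂ W₁ W₂) := by
  intro b a a' ha ha'
  simp only [parallelW] at ha ha'
  by_cases hb : b ≤ n₁
  · rw [if_pos hb] at ha ha'
    exact h₁ b a a' ha ha'
  · rw [if_neg hb] at ha ha'
    have key : ∀ x, ((if x = 0 then W₂ 0 (b - n₁) else if n₁ < x then W₂ (x - n₁) (b - n₁)
        else if x = n₁ ∧ b = n₁ + n₂ then Sum.inl 1 else Sum.inl 0 : k ⊕ σ)).isRight = true →
        (x = 0 ∨ n₁ < x) ∧ (W₂ (if x = 0 then 0 else x - n₁) (b - n₁)).isRight = true := by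
      intro x hx
      split_ifs at hx with hx0 hx1 hx2 <;> simp_all
    obtain ⟨hc, hr⟩ := key a ha
    obtain ⟨hc', hr'⟩ := key a' ha'
    have e := h₂ _ _ _ hr hr'
    split_ifs at e <;> omega

/-- The DAG of every expression has property (D). [cite: BurgisserClausenShokrollahi1997, Thm. (21.27) (D)] -/
theorem ArithExpr.colUnique_dagWeights (φ : ArithExpr k σ) : ColUnique φ.dagWeights := by
  induction φ with
  | var i => exact colUnique_leafW _
  | const c => exact colUnique_leafW _
  | mul φ₁ φ₂ ih₁ ih₂ => exact colUnique_seriesW ih₁ ih₂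
  | add φ₁ φ₂ ih₁ ih₂ => exact colUnique_parallelW ih₁ ih₂

/-- **Property (D)**: the matrix `μ(φ)` has in each column at most one entry which is an
indeterminate (BCS 1997, proof of Thm. (21.27), (D)). [cite: BurgisserClausenShokrollahi1997, Thm. (21.27) (D)] -/
theorem ArithExpr.hasColumnProperty_toMatrix (φ : ArithExpr k σ) : HasColumnProperty φ.toMatrix := by
  intro j i i' hi hi'
  have key : ∀ r : Fin (2 * φ.size + 2), (φ.toMatrix r j).isRight = true →
      (φ.dagWeights r.val (j.val + 1)).isRight = true := by
    intro r hr
    simp only [ArithExpr.toMatrix] at hr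
    split_ifs at hr with h1 h2 <;> simp_all
  exact Fin.ext (φ.colUnique_dagWeights _ _ _ (key i hi) (key i' hi'))

end ExprDAG

end Literature.Computability.AlgebraicComplexity

/-! ### Discharge of the named fact -/

namespace Literature.Computability.AlgebraicComplexity

universe u'

/-- **Discharge of `BCS1997_thm_21_27`** (BCS 1997, Thm. (21.27) for the permanent, with
property (D) of its proof; Valiant 1979): every expression `φ` of size `u` over `k ∪ X` is the
permanent of the `(2u+2) × (2u+2)` matrix `φ.toMatrix` over `k ∪ X`, which has in each column at
most one indeterminate entry. [cite: BurgisserClausenShokrollahi1997, Thm. (21.27)] -/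
theorem BCS1997_thm_21_27_holds (k : Type u') [Field k] : BCS1997_thm_21_27 k :=
  fun φ => ⟨φ.toMatrix, φ.hasColumnProperty_toMatrix, φ.entryPer_toMatrix⟩

end Literature.Computability.AlgebraicComplexity
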